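import Summits.QuantumFields.BalabanUV.T4Continuum.Support.NE7MinActHessianLagrangian
import HarnessLib

/-!
# NE7MinimiserDerivativeLift — THE LINEAR RESPONSE OF THE BACKGROUND FIELD: AT EVERY SMALL DATUM THE DERIVATIVE OF THE MINIMISER SECTION IS A LINEAR RIGHT INVERSE OF THE AVERAGING MAP
# THAT SOLVES THE BORDERED VARIATIONAL PROBLEM (ROAD-G115 §6 (vi); ✓ `NE7MinimiserDerivativeFlat` is the flat case)

Around every minimiser `U♯` over a small unitary `N`-periodic `V₀` with the lift hypothesis (G3′) (✓ p824904 proves it at every small datum): there is a `C¹` section of minimisers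
`y ↦ chart_{U♯} Ψ(y)` over `chart_{V₀} y` (`Ψ : skewSub N → skewSub M`, `Ψ 0 = 0`, the slice-gauge section) whose derivative `H := DΨ(0)` satisfies, for every coarse direction `v`
(`𝒜 = fineAction∘chart_{U♯}`, `𝒢 = levelQ∘chart_{U♯}`, `m = minAct∘chart_{V₀}`, `Q′ = levelQ′ L N j U♯`, `w = stepWt⁻ʲ⁻¹`, bordered functional `𝔅(X) := w·D²𝒜(0)[X,X] − Dm(0)[D²𝒢(0)[X,X]]`):
(a) `Q′(H v) = v`; (b) `𝔅(H v)` is the LEAST element of `{𝔅(X) : X ∈ skewSub M, Q′X = v}`; (c) `D²m(0)[v,v] = 𝔅(H v)` (**`minimiser_derivative_of_lift`**).  In words: the linearisation of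
OUR nonlinear background field `U_{j+1}(V)` at any small datum is the linear operator «minimise the Hessian of the Lagrangian under the linearised averaging constraint» — the
background-dependent analogue of Bałaban's `H_k`, characterised variationally.
MECHANISM: the package of ✓ `NE7MinActC2Lift` (Schur formula), `Ψ := ι_Sl∘θ_Σ∘(id, ι_K∘z⋆)`, the second-order chain rule ✓ `fderiv_fderiv_comp`, the multiplier identity ✓ `NE7MinActMultiplier`,
the constraint identity ✓ `NE7SecondOrderChainRuleVec.fderiv_apply_second_eq_neg`, and the bordered Hessian ✓ `NE7MinActHessianLagrangian` for (b).
Cell `pub-balaban`, rung (B)+1 sub-cell t4, lineage `b2b-balaban-t4-ne7-p1` (CRUX PROVER NE7 #1 = OWNER of BINDER row NE7), generation 115.  Memo `t4/b2b-balaban-t4-ne7-p1-g115/ROAD-G115.md` §6.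
WHAT ([folklore]; 0 def, 0 sorry; `d = 4`, every `U(n)`, `L ≥ 2`).  HONEST FRAMING (page 1): composition of landed kernel theorems over OUR minimisers; (G3′) a HYPOTHESIS here (discharged
level by level by row NE7b's lifting); radii existential; variational characterisation only (no operator formula, no bounds, no uniqueness, no `k`-uniformity); nothing of Bałaban's
asserted; NOT NE7 as a spine node, NOT NE3; spine 0∕9; finite T⁴ rung (B)+1 — NOT infinite volume, NOT mass gap, NOT BetaPertH, NOT Clay.
-/

set_option autoImplicit false

open scoped BigOperators Matrix Matrix.Norms.L2Operator Topology
open NormedSpace Finset Set Filter Metric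

namespace Summit.QuantumFields.BalabanUV.T4Continuum.NE7MinimiserDerivativeLift

open Literature.MathematicalPhysics.QuantumFieldTheory.Balaban1983to89
open B7Prop1Explicit B7Prop2Explicit
open T4AveragingDeficitWall (IsUnitaryCfg SmallField fineAction)
open T4AveragingDeficitWallBoundary (IsPeriodicCfg)
open AveragingDeficitTorusChart (TDir chart chart_zero)
open AveragingDeficitChartCalculus (contDiffAt_fineAction_chart)
open AveragingDeficitTwoLevelPrep (skewSub)
open AveragingDeficitMultiLevelPrep (tower levelQ levelQ' levelQ_self tower_ne_zero)
open AveragingDeficitMultiLevelBridge (tower_eq)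
open AveragingDeficitMultiLevelFermat (hasStrictFDerivAt_levelQ)
open MinimalActionLevels (perWin stepWt stepWt_pos)
open MinimalActionSandwich (IsMinimiser minAct)
open MinimalActionRate (sfClass)
open NE3EnergyShapes (IsUnitarySite IsPeriodicSite)
open NE7MinimalOrbitDatumContinuity (thresholds)
open NE7FibreStraightening (contDiffAt_levelQ)
open NE7SecondOrderChainRule (fderiv_fderiv_comp)
open NE7SecondOrderChainRuleVec (fderiv_fderiv_comp_clm_vec fderiv_apply_second_eq_neg)
open NE7MinActC2Lift (minAct_contDiffAt_two_of_lift)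
open NE7MinActMultiplier (multiplier_eq_fderiv_minAct_of_lift)
open NE7MinActHessianLagrangian (minAct_hessian_lagrangian_of_lift)

noncomputable section

variable {n : Type} [Fintype n] [DecidableEq n]

set_option maxHeartbeats 3200000 in
/-- **THE LINEAR RESPONSE OF THE BACKGROUND FIELD SOLVES THE BORDERED VARIATIONAL PROBLEM** (see the module docstring). [folklore] -/
theorem minimiser_derivative_of_lift [Nonempty n] {L : ℕ} [NeZero L] (hL : 2 ≤ L) :
    ∃ ε₀ : ℝ, 0 < ε₀ ∧ ∀ ε : ℝ, 0 < ε → ε ≤ ε₀ → ∀ (N : ℕ) [NeZero N], 1 ≤ N →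
      ∃ δV : ℝ, 0 < δV ∧
        ∀ V₀ ∈ {V : Site 4 → Fin 4 → (Matrix n n ℂ)ˣ | IsUnitaryCfg V ∧ IsPeriodicCfg V (N : ℤ) ∧ SmallField V δV},
        ∀ (j : ℕ) (Us : Site 4 → Fin 4 → (Matrix n n ℂ)ˣ), IsMinimiser 4 (sfClass 4 L N ε) L N (j + 1) V₀ Us →
        (∀ s : Site 4 → (Matrix n n ℂ)ˣ, IsUnitarySite s → IsPeriodicSite s (N : ℤ) → gaugeAct s V₀ = V₀ →
            ∃ h : Site 4 → (Matrix n n ℂ)ˣ, IsUnitarySite h ∧ IsPeriodicSite h ((N * L ^ (j + 1) : ℕ) : ℤ) ∧ gaugeAct h Us = Us ∧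
              ∀ z : Site 4, h (((L : ℤ) ^ (j + 1)) • z) = s z) →
        ∃ Ψ : ↥(skewSub 4 n N) → ↥(skewSub 4 n (L * tower L N j)), ContDiffAt ℝ 1 Ψ 0 ∧ Ψ 0 = 0 ∧
          (∀ᶠ y : ↥(skewSub 4 n N) in 𝓝 0, IsMinimiser 4 (sfClass 4 L N ε) L N (j + 1) (chart (ContinuousLinearMap.id ℝ (Matrix n n ℂ)) N V₀ (y : TDir 4 n N))
            (chart (ContinuousLinearMap.id ℝ (Matrix n n ℂ)) (L * tower L N j) Us ((Ψ y : ↥(skewSub 4 n (L * tower L N j))) : TDir 4 n (L * tower L N j)))) ∧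
          ∀ v : ↥(skewSub 4 n N),
            levelQ' L N j Us ((fderiv ℝ Ψ 0 v : ↥(skewSub 4 n (L * tower L N j))) : TDir 4 n (L * tower L N j)) = v ∧
            IsLeast {q : ℝ | ∃ X : ↥(skewSub 4 n (L * tower L N j)), levelQ' L N j Us (X : TDir 4 n (L * tower L N j)) = v ∧
                q = ((stepWt 4 L)⁻¹) ^ (j + 1) * fderiv ℝ (fderiv ℝ (fun Φ : ↥(skewSub 4 n (L * tower L N j)) => fineAction (chart (ContinuousLinearMap.id ℝ (Matrix n n ℂ)) (L * tower L N j) Us (Φ : TDir 4 n (L * tower L N j))) (perWin 4 (N * L ^ (j + 1))))) 0 X X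
                  - fderiv ℝ (fun y : ↥(skewSub 4 n N) => minAct 4 (sfClass 4 L N ε) L N (j + 1) (chart (ContinuousLinearMap.id ℝ (Matrix n n ℂ)) N V₀ (y : TDir 4 n N))) 0 (fderiv ℝ (fderiv ℝ (fun Φ : ↥(skewSub 4 n (L * tower L N j)) => levelQ L N j Us (chart (ContinuousLinearMap.id ℝ (Matrix n n ℂ)) (L * tower L N j) Us (Φ : TDir 4 n (L * tower L N j))))) 0 X X)}
              (((stepWt 4 L)⁻¹) ^ (j + 1) * fderiv ℝ (fderiv ℝ (fun Φ : ↥(skewSub 4 n (L * tower L N j)) => fineAction (chart (ContinuousLinearMap.id ℝ (Matrix n n ℂ)) (L * tower L N j) Us (Φ : TDir 4 n (L * tower L N j))) (perWin 4 (N * L ^ (j + 1))))) 0 (fderiv ℝ Ψ 0 v) (fderiv ℝ Ψ 0 v)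
                  - fderiv ℝ (fun y : ↥(skewSub 4 n N) => minAct 4 (sfClass 4 L N ε) L N (j + 1) (chart (ContinuousLinearMap.id ℝ (Matrix n n ℂ)) N V₀ (y : TDir 4 n N))) 0 (fderiv ℝ (fderiv ℝ (fun Φ : ↥(skewSub 4 n (L * tower L N j)) => levelQ L N j Us (chart (ContinuousLinearMap.id ℝ (Matrix n n ℂ)) (L * tower L N j) Us (Φ : TDir 4 n (L * tower L N j))))) 0 (fderiv ℝ Ψ 0 v) (fderiv ℝ Ψ 0 v))) ∧
            fderiv ℝ (fderiv ℝ (fun y : ↥(skewSub 4 n N) => minAct 4 (sfClass 4 L N ε) L N (j + 1) (chart (ContinuousLinearMap.id ℝ (Matrix n n ℂ)) N V₀ (y : TDir 4 n N)))) 0 v v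
              = ((stepWt 4 L)⁻¹) ^ (j + 1) * fderiv ℝ (fderiv ℝ (fun Φ : ↥(skewSub 4 n (L * tower L N j)) => fineAction (chart (ContinuousLinearMap.id ℝ (Matrix n n ℂ)) (L * tower L N j) Us (Φ : TDir 4 n (L * tower L N j))) (perWin 4 (N * L ^ (j + 1))))) 0 (fderiv ℝ Ψ 0 v) (fderiv ℝ Ψ 0 v)
                  - fderiv ℝ (fun y : ↥(skewSub 4 n N) => minAct 4 (sfClass 4 L N ε) L N (j + 1) (chart (ContinuousLinearMap.id ℝ (Matrix n n ℂ)) N V₀ (y : TDir 4 n N))) 0 (fderiv ℝ (fderiv ℝ (fun Φ : ↥(skewSub 4 n (L * tower L N j)) => levelQ L N j Us (chart (ContinuousLinearMap.id ℝ (Matrix n n ℂ)) (L * tower L N j) Us (Φ : TDir 4 n (L * tower L N j))))) 0 (fderiv ℝ Ψ 0 v) (fderiv ℝ Ψ 0 v)) := by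
  have hL1 : 1 ≤ L := by omega
  obtain ⟨ε₁, hε₁, H⟩ := thresholds (n := n) hL
  obtain ⟨ε₂, hε₂, H2⟩ := minAct_contDiffAt_two_of_lift (n := n) hL
  obtain ⟨ε₃, hε₃, H3⟩ := multiplier_eq_fderiv_minAct_of_lift (n := n) hL
  obtain ⟨ε₄, hε₄, H4⟩ := minAct_hessian_lagrangian_of_lift (n := n) hL
  refine ⟨min ε₁ (min ε₂ (min ε₃ ε₄)), lt_min hε₁ (lt_min hε₂ (lt_min hε₃ hε₄)), fun ε hε hεle N _ hN => ?_⟩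
  obtain ⟨-, -, hls, -⟩ := H ε hε (hεle.trans (min_le_left _ _))
  obtain ⟨δ₂, hδ₂, hC2⟩ := H2 ε hε (hεle.trans ((min_le_right _ _).trans (min_le_left _ _))) N hN
  obtain ⟨δ₃, hδ₃, hmult⟩ := H3 ε hε (hεle.trans ((min_le_right _ _).trans ((min_le_right _ _).trans (min_le_left _ _)))) N hN
  obtain ⟨δ₄, hδ₄, hbord⟩ := H4 ε hε (hεle.trans ((min_le_right _ _).trans ((min_le_right _ _).trans (min_le_right _ _)))) N hN
  refine ⟨min δ₂ (min δ₃ δ₄), lt_min hδ₂ (lt_min hδ₃ hδ₄), fun V₀ hV₀ j Us hUs hlift => ?_⟩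
  obtain ⟨hV₀u, hV₀P, hV₀δ⟩ := hV₀
  have hV₀2 : V₀ ∈ {V : Site 4 → Fin 4 → (Matrix n n ℂ)ˣ | IsUnitaryCfg V ∧ IsPeriodicCfg V (N : ℤ) ∧ SmallField V δ₂} :=
    ⟨hV₀u, hV₀P, MinimalActionRate.SmallField.mono hV₀δ (min_le_left _ _)⟩
  have hV₀3 : V₀ ∈ {V : Site 4 → Fin 4 → (Matrix n n ℂ)ˣ | IsUnitaryCfg V ∧ IsPeriodicCfg V (N : ℤ) ∧ SmallField V δ₃} :=
    ⟨hV₀u, hV₀P, MinimalActionRate.SmallField.mono hV₀δ ((min_le_right _ _).trans (min_le_left _ _))⟩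
  have hV₀4 : V₀ ∈ {V : Site 4 → Fin 4 → (Matrix n n ℂ)ˣ | IsUnitaryCfg V ∧ IsPeriodicCfg V (N : ℤ) ∧ SmallField V δ₄} :=
    ⟨hV₀u, hV₀P, MinimalActionRate.SmallField.mono hV₀δ ((min_le_right _ _).trans (min_le_right _ _))⟩
  haveI : NeZero (L * tower L N j) := ⟨Nat.mul_ne_zero (NeZero.ne L) (tower_ne_zero L N j)⟩
  haveI : CompleteSpace ↥(skewSub 4 n (L * tower L N j)) := FiniteDimensional.complete ℝ _
  haveI : CompleteSpace ↥(skewSub 4 n N) := FiniteDimensional.complete ℝ _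
  obtain ⟨Sl, θS, KT, iK, zs, hSlle, hθSc, hθS0, hfib1, -, hzsc, hzs0, hkey, -, -, -, hHess, -⟩ := hC2 V₀ hV₀2 j Us hUs hlift
  obtain ⟨-, hstar⟩ := hmult V₀ hV₀3 j Us hUs hlift
  obtain ⟨-, hleast⟩ := hbord V₀ hV₀4 j Us hUs hlift
  haveI : CompleteSpace ↥Sl := FiniteDimensional.complete ℝ _
  haveI : CompleteSpace ↥KT := FiniteDimensional.complete ℝ _
  set W := perWin 4 (N * L ^ (j + 1)) with hW
  set w : ℝ := ((stepWt 4 L)⁻¹) ^ (j + 1) with hw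
  have hUsU : IsUnitaryCfg Us := hUs.mem.1.1
  have eP : ((N * L ^ (j + 1) : ℕ) : ℤ) = (L : ℤ) * (tower L N j : ℕ) := by rw [tower_eq]; push_cast; ring
  have hUsP' : IsPeriodicCfg Us ((L : ℤ) * (tower L N j : ℕ)) := by rw [← eP]; exact hUs.mem.1.2.1
  set x₀ : ℝ := ε / ((L : ℝ) ^ (j + 1)) ^ 2 with hx₀
  have hx₀0 : 0 < x₀ := by positivity
  have hUsx : SmallField Us x₀ := hUs.mem.1.2.2
  set A : ↥(skewSub 4 n (L * tower L N j)) → ℝ := fun Φ => fineAction (chart (ContinuousLinearMap.id ℝ (Matrix n n ℂ)) (L * tower L N j) Us (Φ : TDir 4 n (L * tower L N j))) W with hA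
  set G : ↥(skewSub 4 n (L * tower L N j)) → ↥(skewSub 4 n N) := fun Φ => levelQ L N j Us (chart (ContinuousLinearMap.id ℝ (Matrix n n ℂ)) (L * tower L N j) Us (Φ : TDir 4 n (L * tower L N j))) with hGdef
  set m : ↥(skewSub 4 n N) → ℝ := fun y => minAct 4 (sfClass 4 L N ε) L N (j + 1) (chart (ContinuousLinearMap.id ℝ (Matrix n n ℂ)) N V₀ (y : TDir 4 n N)) with hm
  have hAc : ContDiffAt ℝ 2 A 0 := by
    have h1 : ContDiffAt ℝ 2 (fun Φ : TDir 4 n (L * tower L N j) => fineAction (chart (ContinuousLinearMap.id ℝ (Matrix n n ℂ)) (L * tower L N j) Us Φ) W) ((skewSub 4 n (L * tower L N j)).subtypeL 0) := by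
      rw [map_zero]; exact contDiffAt_fineAction_chart (m := 2) (ContinuousLinearMap.id ℝ (Matrix n n ℂ)) (L * tower L N j) Us W 0
    exact h1.comp 0 (skewSub 4 n (L * tower L N j)).subtypeL.contDiff.contDiffAt
  have hGc : ContDiffAt ℝ 2 G 0 := by
    have h1 : ContDiffAt ℝ 2 (fun Φ : TDir 4 n (L * tower L N j) => levelQ L N j Us (chart (ContinuousLinearMap.id ℝ (Matrix n n ℂ)) (L * tower L N j) Us Φ)) ((skewSub 4 n (L * tower L N j)).subtypeL 0) := by
      rw [map_zero]; exact contDiffAt_levelQ (d := 4) (m := 2) hL1 j hUsU hUsP' hx₀0.le (hls j) hUsx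
    exact h1.comp 0 (skewSub 4 n (L * tower L N j)).subtypeL.contDiff.contDiffAt
  have hG : HasStrictFDerivAt (fun Φ : TDir 4 n (L * tower L N j) => levelQ L N j Us (chart (ContinuousLinearMap.id ℝ (Matrix n n ℂ)) (L * tower L N j) Us Φ)) (levelQ' L N j Us) 0 :=
    hasStrictFDerivAt_levelQ (d := 4) hL1 j hUsU hUsP' hx₀0.le (hls j) hUsx
  have hGs : HasFDerivAt G ((levelQ' L N j Us).comp (skewSub 4 n (L * tower L N j)).subtypeL) 0 := by
    have h1 : HasFDerivAt (fun Φ : TDir 4 n (L * tower L N j) => levelQ L N j Us (chart (ContinuousLinearMap.id ℝ (Matrix n n ℂ)) (L * tower L N j) Us Φ)) (levelQ' L N j Us)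
        ((skewSub 4 n (L * tower L N j)).subtypeL 0) := by rw [map_zero]; exact hG.hasFDerivAt
    exact h1.comp 0 (skewSub 4 n (L * tower L N j)).subtypeL.hasFDerivAt
  have hGs' : ∀ Z : ↥(skewSub 4 n (L * tower L N j)), fderiv ℝ G 0 Z = levelQ' L N j Us (Z : TDir 4 n (L * tower L N j)) := fun Z => by
    rw [hGs.fderiv]; rfl
  -- the section `Ψ` and its derivative
  set inclSl : ↥Sl →L[ℝ] ↥(skewSub 4 n (L * tower L N j)) := LinearMap.toContinuousLinearMap (Submodule.inclusion hSlle) with hinclSl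
  set ι : ↥(skewSub 4 n N) × ↥KT →L[ℝ] ↥(skewSub 4 n N) × ↥Sl := (ContinuousLinearMap.id ℝ ↥(skewSub 4 n N)).prodMap iK with hι
  set Θ : ↥(skewSub 4 n N) × ↥KT → ↥(skewSub 4 n (L * tower L N j)) := fun p => inclSl (θS (ι p)) with hΘ
  have hιp : ∀ p : ↥(skewSub 4 n N) × ↥KT, ι p = (p.1, iK p.2) := fun p => rfl
  have hΘval : ∀ p : ↥(skewSub 4 n N) × ↥KT, ((Θ p : ↥(skewSub 4 n (L * tower L N j))) : TDir 4 n (L * tower L N j)) = ((θS (p.1, iK p.2) : ↥Sl) : TDir 4 n (L * tower L N j)) := fun p => rfl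
  have hgΘ : (fun p : ↥(skewSub 4 n N) × ↥KT => fineAction (chart (ContinuousLinearMap.id ℝ (Matrix n n ℂ)) (L * tower L N j) Us
      ((θS (p.1, iK p.2) : ↥Sl) : TDir 4 n (L * tower L N j))) (perWin 4 (N * L ^ (j + 1)))) = fun p => A (Θ p) := by
    funext p
    show _ = fineAction (chart (ContinuousLinearMap.id ℝ (Matrix n n ℂ)) (L * tower L N j) Us ((Θ p : ↥(skewSub 4 n (L * tower L N j))) : TDir 4 n (L * tower L N j))) W
    rw [hΘval p]
  have hΘ0 : Θ 0 = 0 := by simp only [hΘ, map_zero, hθS0]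
  have hΘc : ContDiffAt ℝ 2 Θ 0 := by
    have h1 : ContDiffAt ℝ 2 θS (ι 0) := by rw [map_zero]; exact hθSc
    exact inclSl.contDiff.contDiffAt.comp 0 (h1.comp 0 ι.contDiff.contDiffAt)
  have hΘd : HasFDerivAt Θ (inclSl.comp ((fderiv ℝ θS 0).comp ι)) 0 := by
    have h1 : HasFDerivAt θS (fderiv ℝ θS 0) (ι 0) := by rw [map_zero]; exact (hθSc.differentiableAt (by simp)).hasFDerivAt
    exact inclSl.hasFDerivAt.comp 0 (h1.comp 0 ι.hasFDerivAt)
  set Γ : ↥(skewSub 4 n N) → ↥(skewSub 4 n N) × ↥KT := fun y => (y, zs y) with hΓ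
  set Ψ : ↥(skewSub 4 n N) → ↥(skewSub 4 n (L * tower L N j)) := fun y => Θ (Γ y) with hΨ
  have hΨval : ∀ y, ((Ψ y : ↥(skewSub 4 n (L * tower L N j))) : TDir 4 n (L * tower L N j)) = ((θS (y, iK (zs y)) : ↥Sl) : TDir 4 n (L * tower L N j)) := fun y => rfl
  have hΓ0 : Γ 0 = 0 := by simp only [hΓ, hzs0, Prod.mk_zero_zero]
  have hΓc : ContDiffAt ℝ 1 Γ 0 := contDiffAt_id.prodMk hzsc
  have hΓd : HasFDerivAt Γ ((ContinuousLinearMap.id ℝ ↥(skewSub 4 n N)).prod (fderiv ℝ zs 0)) 0 :=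
    (hasFDerivAt_id (0 : ↥(skewSub 4 n N))).prodMk (hzsc.differentiableAt one_ne_zero).hasFDerivAt
  have hΨc : ContDiffAt ℝ 1 Ψ 0 := by
    have h1 : ContDiffAt ℝ 1 Θ (Γ 0) := by rw [hΓ0]; exact hΘc.of_le (by norm_num)
    exact h1.comp 0 hΓc
  have hΨ0 : Ψ 0 = 0 := by simp only [hΨ, hΓ0, hΘ0]
  have hΨd : HasFDerivAt Ψ ((fderiv ℝ Θ 0).comp ((ContinuousLinearMap.id ℝ ↥(skewSub 4 n N)).prod (fderiv ℝ zs 0))) 0 := by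
    have h1 : ∀ p : ↥(skewSub 4 n N) × ↥KT, p = 0 → HasFDerivAt Θ (fderiv ℝ Θ 0) p := fun p hp => by rw [hp]; exact hΘd.differentiableAt.hasFDerivAt
    exact (h1 _ hΓ0).comp 0 hΓd
  have hkeyΨ : ∀ᶠ y : ↥(skewSub 4 n N) in 𝓝 0, IsMinimiser 4 (sfClass 4 L N ε) L N (j + 1) (chart (ContinuousLinearMap.id ℝ (Matrix n n ℂ)) N V₀ (y : TDir 4 n N))
      (chart (ContinuousLinearMap.id ℝ (Matrix n n ℂ)) (L * tower L N j) Us ((Ψ y : ↥(skewSub 4 n (L * tower L N j))) : TDir 4 n (L * tower L N j))) := hkey.mono fun y hy => by rw [hΨval y]; exact hy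
  refine ⟨Ψ, hΨc, hΨ0, hkeyΨ, fun v => ?_⟩
  set ζ : ↥KT := fderiv ℝ zs 0 v with hζ
  have hHv : fderiv ℝ Ψ 0 v = fderiv ℝ Θ 0 (v, ζ) := by
    rw [hΨd.fderiv]; rfl
  -- (a) `Q′(H v) = v`
  have ha : levelQ' L N j Us ((fderiv ℝ Ψ 0 v : ↥(skewSub 4 n (L * tower L N j))) : TDir 4 n (L * tower L N j)) = v := by
    have hΘd' : HasFDerivAt (fun p : ↥(skewSub 4 n N) × ↥Sl => ((θS p : ↥Sl) : TDir 4 n (L * tower L N j))) (Sl.subtypeL.comp (fderiv ℝ θS 0)) 0 :=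
      Sl.subtypeL.hasFDerivAt.comp 0 (hθSc.differentiableAt (by simp)).hasFDerivAt
    have hΘ0' : (fun p : ↥(skewSub 4 n N) × ↥Sl => ((θS p : ↥Sl) : TDir 4 n (L * tower L N j))) 0 = 0 := by simp only [hθS0, Submodule.coe_zero]
    have hG' : HasFDerivAt (fun Φ : TDir 4 n (L * tower L N j) => levelQ L N j Us (chart (ContinuousLinearMap.id ℝ (Matrix n n ℂ)) (L * tower L N j) Us Φ)) (levelQ' L N j Us)
        ((fun p : ↥(skewSub 4 n N) × ↥Sl => ((θS p : ↥Sl) : TDir 4 n (L * tower L N j))) 0) := by rw [hΘ0']; exact hG.hasFDerivAt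
    have hF := hG'.comp 0 hΘd'
    have hF' : HasFDerivAt (fun p : ↥(skewSub 4 n N) × ↥Sl => levelQ L N j Us (chart (ContinuousLinearMap.id ℝ (Matrix n n ℂ)) (L * tower L N j) Us ((θS p : ↥Sl) : TDir 4 n (L * tower L N j))))
        (ContinuousLinearMap.fst ℝ ↥(skewSub 4 n N) ↥Sl) 0 :=
      (hasFDerivAt_fst (𝕜 := ℝ) (p := (0 : ↥(skewSub 4 n N) × ↥Sl))).congr_of_eventuallyEq (hfib1.mono fun p hp => hp)
    have h := congrArg (fun T : ↥(skewSub 4 n N) × ↥Sl →L[ℝ] ↥(skewSub 4 n N) => T (v, iK ζ)) (hF.unique hF')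
    simp only [ContinuousLinearMap.comp_apply, Submodule.subtypeL_apply, ContinuousLinearMap.coe_fst'] at h
    rw [hHv, hΘd.fderiv]
    simp only [ContinuousLinearMap.comp_apply, hιp, hinclSl, LinearMap.coe_toContinuousLinearMap', Submodule.coe_inclusion]
    exact h
  -- (c) `D²m(0)[v,v] = 𝔅(H v)`
  have hc : fderiv ℝ (fderiv ℝ m) 0 v v
      = w * fderiv ℝ (fderiv ℝ A) 0 (fderiv ℝ Ψ 0 v) (fderiv ℝ Ψ 0 v) - fderiv ℝ m 0 (fderiv ℝ (fderiv ℝ G) 0 (fderiv ℝ Ψ 0 v) (fderiv ℝ Ψ 0 v)) := by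
    have hAcΘ : ContDiffAt ℝ 2 A (Θ 0) := by rw [hΘ0]; exact hAc
    have hD2 := fderiv_fderiv_comp hAcΘ hΘc (v, ζ) (v, ζ)
    rw [hΘ0] at hD2
    set ℓs : ℝ →L[ℝ] ↥(skewSub 4 n N) × ↥KT := ContinuousLinearMap.toSpanSingleton ℝ ((v, ζ) : ↥(skewSub 4 n N) × ↥KT) with hℓs
    have hℓs1 : ℓs 1 = (v, ζ) := ContinuousLinearMap.toSpanSingleton_apply_one ℝ _
    have hcs : ContDiffAt ℝ 2 (fun t : ℝ => Θ (ℓs t)) 0 := by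
      have h1 : ContDiffAt ℝ 2 Θ (ℓs 0) := by rw [map_zero]; exact hΘc
      exact ContDiffAt.comp (g := Θ) (f := fun t : ℝ => ℓs t) 0 h1 ℓs.contDiff.contDiffAt
    have hcs0 : (fun t : ℝ => Θ (ℓs t)) 0 = 0 := by simp only [map_zero, hΘ0]
    have hcs' : fderiv ℝ (fun t : ℝ => Θ (ℓs t)) 0 1 = fderiv ℝ Ψ 0 v := by
      have h1 : ∀ p : ↥(skewSub 4 n N) × ↥KT, p = 0 → HasFDerivAt Θ (fderiv ℝ Θ 0) p := fun p hp => by rw [hp]; exact hΘd.differentiableAt.hasFDerivAt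
      have h2 : HasFDerivAt (fun t : ℝ => Θ (ℓs t)) ((fderiv ℝ Θ 0).comp ℓs) 0 := (h1 _ (map_zero ℓs)).comp 0 ℓs.hasFDerivAt
      rw [h2.fderiv, ContinuousLinearMap.comp_apply, hℓs1, hHv]
    have hcs'' : fderiv ℝ (fderiv ℝ (fun t : ℝ => Θ (ℓs t))) 0 1 1 = fderiv ℝ (fderiv ℝ Θ) 0 (v, ζ) (v, ζ) := by
      have h1 : ContDiffAt ℝ 2 Θ (ℓs 0) := by rw [map_zero]; exact hΘc
      rw [fderiv_fderiv_comp_clm_vec ℓs h1, map_zero, hℓs1]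
    have hlin : (fun t : ℝ => G (Θ (ℓs t))) =ᶠ[𝓝 0] fun t : ℝ => t • v := by
      have ht : Tendsto (fun t : ℝ => ι (ℓs t)) (𝓝 0) (𝓝 0) := by
        have h := (ι.comp ℓs).continuous.tendsto (0 : ℝ); rwa [map_zero] at h
      filter_upwards [ht.eventually hfib1] with t hft
      show levelQ L N j Us (chart (ContinuousLinearMap.id ℝ (Matrix n n ℂ)) (L * tower L N j) Us ((Θ (ℓs t) : ↥(skewSub 4 n (L * tower L N j))) : TDir 4 n (L * tower L N j))) = t • v
      rw [hΘval, ← hιp, hft]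
      simp only [hιp, hℓs, ContinuousLinearMap.toSpanSingleton_apply, Prod.smul_fst]
    have hGcc : ContDiffAt ℝ 2 G ((fun t : ℝ => Θ (ℓs t)) 0) := by rw [hcs0]; exact hGc
    have hci := fderiv_apply_second_eq_neg hGcc hcs hlin
    have hcs0' : Θ (ℓs 0) = 0 := by rw [map_zero, hΘ0]
    simp only [hcs0'] at hci
    rw [hGs', hcs', hcs''] at hci
    have hst := hstar (fderiv ℝ (fderiv ℝ Θ) 0 (v, ζ) (v, ζ))
    rw [hci, map_neg] at hst
    rw [hHess v v, hgΘ, hD2, mul_add, hst, hHv]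
    ring
  refine ⟨ha, ?_, hc⟩
  -- (b) `H v` attains the minimum
  rw [← hc]
  exact hleast v

end

end Summit.QuantumFields.BalabanUV.T4Continuum.NE7MinimiserDerivativeLift
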